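import Summits.AtomisticToContinuum.FouriersLaw.Theorems.VanishingNoiseTransferNoisyFourierFlipResolventSetwise

/-!
# Resolvent identification of weak flip steady states, part 7: the setwise resolvent inequality (forward side)

Helper file for crux `NoisyFourier` (stmt-AtomisticToContinuum-11977, route `VanishingNoiseTransfer`), line
`sector-dirichlet-gluing`, registered stub `stub_flipSteadyState_eq_bind_resolventKernel`. The reversed-side
inequality of part 6 is transported to the forward transition kernels `P_t` of the chain by the Lebesgue duality
`dx P_t(x,dy) = e^{2γt} dy P̂_t(y,dx)` (`LangevinChainReversal.lean`): for smooth confining potentials, `N ≥ 1`,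
`T_L, T_R ≥ 0`, a `C²` integrable `ρ ≥ 0` solving `L̂ρ + cρ + g = 0` with a continuous integrable source `g ≥ 0` and
polynomial volume growth of the energy sublevel sets,

* `lintegral_density_kernel_add_le_src` — for `t > 0` and measurable `A`,
  `e^{(c-2γ)t} ∫ ρ(x) P_t(x,A) dx + ∫_{0<s≤t} e^{(c-2γ)s} ∫ g(x) P_s(x,A) dx ds ≤ ∫_A ρ dx`;
* `lintegral_Ioi_kernel_le_src` — hence `∫_{s>0} e^{(c-2γ)s} ∫ g(x) P_s(x,A) dx ds ≤ ∫_A ρ dx`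
  (drop the first term, monotone convergence in `t`).

For the flip steady state (`c = 2γ - Nε`, `g = ε∑ᵢ ρ∘Θᵢ`) the left side is `((μQ) R_{Nε})(A)` up to the mass
normalisation of the resolvent, and equality of total masses finishes the identification (part 8). No definitions.
-/

noncomputable section

open MeasureTheory ProbabilityTheory Filter Topology Set
open scoped NNReal ENNReal ContDiff

namespace Summit.AtomisticToContinuum.FouriersLaw.Theorems.NoisyFourier.FlipResolvent

open Literature.MathematicalPhysics.KineticTheory.HeatConduction
open Literature.MathematicalPhysics.KineticTheory Literature.Probability.Process OscillatorChain
open Summit.AtomisticToContinuum.FouriersLaw.Theorems.SubdiffusiveBondHeat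
open Summit.AtomisticToContinuum.FouriersLaw.Theorems.NessUnique

variable {N : ℕ} {P : OscillatorChain}

section Forward

variable (hU : ContDiff ℝ ((⊤ : ℕ∞) : WithTop ℕ∞) P.U)
  (hV : ContDiff ℝ ((⊤ : ℕ∞) : WithTop ℕ∞) P.V) (hN : 0 < N) {T_L T_R : ℝ} (hTL : 0 ≤ T_L) (hTR : 0 ≤ T_R)
  {ρ : PhaseSpace N → ℝ} (hρ : ContDiff ℝ 2 ρ) (hρ0 : ∀ x, 0 ≤ ρ x) (hρi : Integrable ρ)
  {c : ℝ} {g : PhaseSpace N → ℝ} (hg : Continuous g) (hg0 : ∀ x, 0 ≤ g x) (hgi : Integrable g)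
  (hpde : ∀ x, sdeGenerator (fun y => -P.drift N y) (P.bathVecL N T_L) (P.bathVecR N T_R) ρ x +
    c * ρ x + g x = 0)
  (hvol : ∃ (C : ℝ) (d : ℕ), 0 ≤ C ∧ ∀ R : ℝ, 1 ≤ R →
    (volume {x : PhaseSpace N | P.hamiltonian N x ≤ 4 * R}).toReal ≤ C * R ^ d)

include hU hV hN in
/-- **Duality for a weighted density**: for measurable `h ≥ 0`, measurable `A` and `t > 0`,
`∫_A (∫ h dP̂_t(y,·)) dy = e^{-2γt} ∫ h(x) P_t(x, A) dx`. [folklore] -/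
theorem setLIntegral_revKernel_eq (hP : P.IsConfining) {t : ℝ≥0} (ht : 0 < t) {h : PhaseSpace N → ℝ≥0∞}
    (hh : Measurable h) {A : Set (PhaseSpace N)} (hA : MeasurableSet A) :
    ∫⁻ y in A, ∫⁻ x, h x ∂(P.langevinRevKernel N T_L T_R t y) =
      ENNReal.ofReal (Real.exp (-(2 * P.γ * t))) * ∫⁻ x, h x * (P.langevinKernel N T_L T_R t x) A := by
  have h1m : Measurable (A.indicator fun _ : PhaseSpace N => (1:ℝ≥0∞)) := measurable_const.indicator hA
  set Hf : PhaseSpace N × PhaseSpace N → ℝ≥0∞ := fun p => h p.1 * A.indicator (fun _ => (1:ℝ≥0∞)) p.2 with hHf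
  have hHm : Measurable Hf := (hh.comp measurable_fst).mul (h1m.comp measurable_snd)
  have hdual := hP.lintegral_langevinKernel_duality (T_L := T_L) (T_R := T_R) hU hV hN ht hHm
  have hL : ∀ x, ∫⁻ y, Hf (x, y) ∂(P.langevinKernel N T_L T_R t x) = h x * (P.langevinKernel N T_L T_R t x) A := by
    intro x
    simp only [hHf]
    rw [lintegral_const_mul _ h1m, lintegral_indicator_const hA, one_mul]
  have hR : ∀ y, ∫⁻ x, Hf (x, y) ∂(P.langevinRevKernel N T_L T_R t y) =
      A.indicator (fun _ => (1:ℝ≥0∞)) y * ∫⁻ x, h x ∂(P.langevinRevKernel N T_L T_R t y) := by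
    intro y
    simp only [hHf]
    rw [lintegral_mul_const _ hh, mul_comm]
  simp_rw [hL, hR] at hdual
  have hind : ∫⁻ y, A.indicator (fun _ => (1:ℝ≥0∞)) y * ∫⁻ x, h x ∂(P.langevinRevKernel N T_L T_R t y) =
      ∫⁻ y in A, ∫⁻ x, h x ∂(P.langevinRevKernel N T_L T_R t y) := by
    rw [← lintegral_indicator hA]
    refine lintegral_congr fun y => ?_
    by_cases hy : y ∈ A
    · simp [hy]
    · simp [hy]
  rw [hind] at hdual
  -- divide by `e^{2γt}`
  have hexp : ENNReal.ofReal (Real.exp (-(2 * P.γ * t))) * ENNReal.ofReal (Real.exp (2 * P.γ * t)) = 1 := by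
    rw [← ENNReal.ofReal_mul (Real.exp_pos _).le, ← Real.exp_add, neg_add_cancel, Real.exp_zero, ENNReal.ofReal_one]
  calc ∫⁻ y in A, ∫⁻ x, h x ∂(P.langevinRevKernel N T_L T_R t y)
      = (ENNReal.ofReal (Real.exp (-(2 * P.γ * t))) * ENNReal.ofReal (Real.exp (2 * P.γ * t))) *
          ∫⁻ y in A, ∫⁻ x, h x ∂(P.langevinRevKernel N T_L T_R t y) := by rw [hexp, one_mul]
    _ = ENNReal.ofReal (Real.exp (-(2 * P.γ * t))) * ∫⁻ x, h x * (P.langevinKernel N T_L T_R t x) A := by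
        rw [mul_assoc, ← hdual]

set_option maxHeartbeats 800000 in
include hU hV hN hg in
/-- **Duality for the weighted source at a positive time**: for real `s > 0` and measurable `A`,
`∫_A (∫ e^{cs} g dP̂_s(y,·)) dy = e^{(c-2γ)s} ∫ g(x) P_s(x, A) dx`. [folklore] -/
theorem setLIntegral_revKernel_weighted_eq (hP : P.IsConfining) {s : ℝ} (hs : 0 < s) {A : Set (PhaseSpace N)}
    (hA : MeasurableSet A) :
    ∫⁻ y in A, ∫⁻ x, ENNReal.ofReal (Real.exp (c * s) * g x) ∂(P.langevinRevKernel N T_L T_R s.toNNReal y) =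
      ENNReal.ofReal (Real.exp ((c - 2 * P.γ) * s)) *
        ∫⁻ x, ENNReal.ofReal (g x) * (P.langevinKernel N T_L T_R s.toNNReal x) A := by
  have hgm : Measurable fun x => ENNReal.ofReal (g x) := hg.measurable.ennreal_ofReal
  have hs' : 0 < s.toNNReal := Real.toNNReal_pos.2 hs
  have hmy : Measurable fun y => ∫⁻ x, ENNReal.ofReal (g x) ∂(P.langevinRevKernel N T_L T_R s.toNNReal y) := by
    have hm1 := measurable_lintegral_revKernel T_L T_R hP hgm
    have hm2 : Measurable fun y : PhaseSpace N => (y, s) := measurable_id.prodMk measurable_const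
    have hm3 := hm1.comp hm2
    dsimp only [Function.comp_def] at hm3
    exact hm3
  have e1 : ∀ y, ∫⁻ x, ENNReal.ofReal (Real.exp (c * s) * g x) ∂(P.langevinRevKernel N T_L T_R s.toNNReal y) =
      ENNReal.ofReal (Real.exp (c * s)) * ∫⁻ x, ENNReal.ofReal (g x) ∂(P.langevinRevKernel N T_L T_R s.toNNReal y) := by
    intro y
    rw [← lintegral_const_mul _ hgm]
    refine lintegral_congr fun x => ?_
    rw [ENNReal.ofReal_mul (Real.exp_pos _).le]
  have hcoe : ((s.toNNReal : ℝ≥0) : ℝ) = s := Real.coe_toNNReal _ hs.le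
  have e2 : Real.exp (c * s) * Real.exp (-(2 * P.γ * (s.toNNReal : ℝ))) = Real.exp ((c - 2 * P.γ) * s) := by
    rw [hcoe, ← Real.exp_add]
    congr 1; ring
  calc ∫⁻ y in A, ∫⁻ x, ENNReal.ofReal (Real.exp (c * s) * g x) ∂(P.langevinRevKernel N T_L T_R s.toNNReal y)
      = ∫⁻ y in A, ENNReal.ofReal (Real.exp (c * s)) *
          ∫⁻ x, ENNReal.ofReal (g x) ∂(P.langevinRevKernel N T_L T_R s.toNNReal y) := lintegral_congr fun y => e1 y
    _ = ENNReal.ofReal (Real.exp (c * s)) *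
          ∫⁻ y in A, ∫⁻ x, ENNReal.ofReal (g x) ∂(P.langevinRevKernel N T_L T_R s.toNNReal y) :=
        lintegral_const_mul _ hmy
    _ = ENNReal.ofReal (Real.exp (c * s)) * (ENNReal.ofReal (Real.exp (-(2 * P.γ * (s.toNNReal : ℝ)))) *
          ∫⁻ x, ENNReal.ofReal (g x) * (P.langevinKernel N T_L T_R s.toNNReal x) A) := by
        rw [setLIntegral_revKernel_eq hU hV hN hP hs' hgm hA]
    _ = ENNReal.ofReal (Real.exp ((c - 2 * P.γ) * s)) *
          ∫⁻ x, ENNReal.ofReal (g x) * (P.langevinKernel N T_L T_R s.toNNReal x) A := by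
        rw [← mul_assoc, ← ENNReal.ofReal_mul (Real.exp_pos _).le, e2]

include hg in
/-- Joint measurability of `(y, s) ↦ ∫ e^{cs} g dP̂_{s⁺}(y, ·)`. [folklore] -/
theorem measurable_weighted_revKernel (hP : P.IsConfining) :
    Measurable (Function.uncurry fun (y : PhaseSpace N) (s : ℝ) =>
      ∫⁻ x, ENNReal.ofReal (Real.exp (c * s) * g x) ∂(P.langevinRevKernel N T_L T_R s.toNNReal y)) := by
  have hgm : Measurable fun x => ENNReal.ofReal (g x) := hg.measurable.ennreal_ofReal
  have e : (Function.uncurry fun (y : PhaseSpace N) (s : ℝ) =>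
      ∫⁻ x, ENNReal.ofReal (Real.exp (c * s) * g x) ∂(P.langevinRevKernel N T_L T_R s.toNNReal y)) =
      fun p => ENNReal.ofReal (Real.exp (c * p.2)) *
        ∫⁻ x, ENNReal.ofReal (g x) ∂(P.langevinRevKernel N T_L T_R p.2.toNNReal p.1) := by
    funext p
    simp only [Function.uncurry]
    rw [← lintegral_const_mul _ hgm]
    refine lintegral_congr fun x => ?_
    rw [ENNReal.ofReal_mul (Real.exp_pos _).le]
  rw [e]
  exact ((Real.continuous_exp.comp (continuous_const.mul continuous_snd)).measurable.ennreal_ofReal).mul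
    (measurable_lintegral_revKernel T_L T_R hP hgm)

set_option maxHeartbeats 800000 in
include hU hV hN hTL hTR hρ hρ0 hρi hg hg0 hgi hpde hvol in
/-- **The setwise resolvent inequality on the forward side.** For `t > 0` and measurable `A`,
`e^{(c-2γ)t} ∫ ρ(x) P_t(x,A) dx + ∫_{0<s≤t} e^{(c-2γ)s} ∫ g(x) P_s(x,A) dx ds ≤ ∫_A ρ dx`. [folklore] -/
theorem lintegral_density_kernel_add_le_src (hP : P.IsConfining) {t : ℝ≥0} (ht : 0 < t) {A : Set (PhaseSpace N)}
    (hA : MeasurableSet A) :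
    (ENNReal.ofReal (Real.exp ((c - 2 * P.γ) * t)) * ∫⁻ x, ENNReal.ofReal (ρ x) * (P.langevinKernel N T_L T_R t x) A) +
      (∫⁻ s in Set.Ioc (0 : ℝ) t, ENNReal.ofReal (Real.exp ((c - 2 * P.γ) * s)) *
        ∫⁻ x, ENNReal.ofReal (g x) * (P.langevinKernel N T_L T_R s.toNNReal x) A) ≤
      ∫⁻ x in A, ENNReal.ofReal (ρ x) := by
  have hρm : Measurable fun x => ENNReal.ofReal (ρ x) := hρ.continuous.measurable.ennreal_ofReal
  have hgm : Measurable fun x => ENNReal.ofReal (g x) := hg.measurable.ennreal_ofReal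
  have hkey := setLIntegral_revKernel_density_add_le_src hU hV hN hTL hTR hρ hρ0 hρi hg hg0 hgi hpde hvol hP t A
  -- first term
  have h1 : ENNReal.ofReal (Real.exp (c * t)) * ∫⁻ y in A, ∫⁻ x, ENNReal.ofReal (ρ x) ∂(P.langevinRevKernel N T_L T_R t y) =
      ENNReal.ofReal (Real.exp ((c - 2 * P.γ) * t)) * ∫⁻ x, ENNReal.ofReal (ρ x) * (P.langevinKernel N T_L T_R t x) A := by
    rw [setLIntegral_revKernel_eq hU hV hN hP ht hρm hA, ← mul_assoc, ← ENNReal.ofReal_mul (Real.exp_pos _).le,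
      ← Real.exp_add]
    congr 2; ring
  -- second term: swap the `y`- and `s`-integrals and use the weighted duality at each `s > 0`
  have hswap := lintegral_lintegral_swap (μ := volume.restrict A) (ν := volume.restrict (Set.Ioc (0:ℝ) t))
    ((measurable_weighted_revKernel (T_L := T_L) (T_R := T_R) (c := c) hg hP).aemeasurable)
  have h2 : ∫⁻ y in A, ∫⁻ s in Set.Ioc (0 : ℝ) t, ∫⁻ x, ENNReal.ofReal (Real.exp (c * s) * g x)
        ∂(P.langevinRevKernel N T_L T_R s.toNNReal y) = ∫⁻ s in Set.Ioc (0 : ℝ) t,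
      ENNReal.ofReal (Real.exp ((c - 2 * P.γ) * s)) * ∫⁻ x, ENNReal.ofReal (g x) * (P.langevinKernel N T_L T_R s.toNNReal x) A := by
    rw [hswap]
    refine setLIntegral_congr_fun measurableSet_Ioc fun s hs => ?_
    exact setLIntegral_revKernel_weighted_eq hU hV hN hg hP hs.1 hA
  rw [← h1, ← h2]
  exact hkey

set_option maxHeartbeats 800000 in
include hU hV hN hTL hTR hρ hρ0 hρi hg hg0 hgi hpde hvol in
/-- **The resolvent inequality for all positive times**: for measurable `A`,
`∫_{s>0} e^{(c-2γ)s} ∫ g(x) P_s(x,A) dx ds ≤ ∫_A ρ dx` (drop the first term of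
`lintegral_density_kernel_add_le_src` and let `t → ∞` by monotone convergence). [folklore] -/
theorem lintegral_Ioi_kernel_le_src (hP : P.IsConfining) {A : Set (PhaseSpace N)} (hA : MeasurableSet A) :
    ∫⁻ s in Set.Ioi (0 : ℝ), ENNReal.ofReal (Real.exp ((c - 2 * P.γ) * s)) *
        ∫⁻ x, ENNReal.ofReal (g x) * (P.langevinKernel N T_L T_R s.toNNReal x) A ≤
      ∫⁻ x in A, ENNReal.ofReal (ρ x) := by
  set F : ℝ → ℝ≥0∞ := fun s => ENNReal.ofReal (Real.exp ((c - 2 * P.γ) * s)) *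
    ∫⁻ x, ENNReal.ofReal (g x) * (P.langevinKernel N T_L T_R s.toNNReal x) A with hF
  have hgm : Measurable fun x => ENNReal.ofReal (g x) := hg.measurable.ennreal_ofReal
  -- measurability of `F`
  have hFm : Measurable F := by
    have h0 := (hP.measurable_langevinKernel N T_L T_R).comp
      ((measurable_real_toNNReal.comp measurable_snd).prodMk (measurable_fst (α := PhaseSpace N) (β := ℝ)))
    have h1 : Measurable fun p : PhaseSpace N × ℝ => P.langevinKernel N T_L T_R p.2.toNNReal p.1 := by
      dsimp only [Function.comp_def] at h0
      exact h0
    have hk' : Measurable fun p : PhaseSpace N × ℝ => (P.langevinKernel N T_L T_R p.2.toNNReal p.1) A :=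
      (Measure.measurable_measure.1 h1) A hA
    have hprod : Measurable fun p : PhaseSpace N × ℝ =>
        ENNReal.ofReal (g p.1) * (P.langevinKernel N T_L T_R p.2.toNNReal p.1) A :=
      (hgm.comp (measurable_fst (α := PhaseSpace N) (β := ℝ))).mul hk'
    have hint : Measurable fun s : ℝ => ∫⁻ x, ENNReal.ofReal (g x) * (P.langevinKernel N T_L T_R s.toNNReal x) A := by
      have h := hprod.lintegral_prod_left' (μ := (volume : Measure (PhaseSpace N)))
      dsimp only at h
      exact h
    have hexpm : Measurable fun s : ℝ => ENNReal.ofReal (Real.exp ((c - 2 * P.γ) * s)) :=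
      (Real.continuous_exp.comp (continuous_const.mul continuous_id)).measurable.ennreal_ofReal
    exact hexpm.mul hint
  -- each truncated integral is bounded
  have hle : ∀ n : ℕ, ∫⁻ s in Set.Ioc (0:ℝ) ((n : ℝ) + 1), F s ≤ ∫⁻ x in A, ENNReal.ofReal (ρ x) := by
    intro n
    have ht : (0 : ℝ≥0) < (n : ℝ≥0) + 1 := by positivity
    have h := lintegral_density_kernel_add_le_src hU hV hN hTL hTR hρ hρ0 hρi hg hg0 hgi hpde hvol hP ht hA
    have e : (((n : ℝ≥0) + 1 : ℝ≥0) : ℝ) = (n : ℝ) + 1 := by push_cast; ring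
    rw [e] at h
    exact le_trans le_add_self h
  -- monotone convergence `Ioc 0 (n+1) ↑ Ioi 0`
  have hmono : Monotone fun n : ℕ => (Set.Ioc (0:ℝ) ((n : ℝ) + 1)).indicator F := by
    intro m n hmn s
    refine Set.indicator_le_indicator_of_subset (Set.Ioc_subset_Ioc_right ?_) (fun _ => zero_le) s
    have : (m : ℝ) ≤ n := by exact_mod_cast hmn
    linarith
  have hunion : ∀ s, (⨆ n : ℕ, (Set.Ioc (0:ℝ) ((n : ℝ) + 1)).indicator F s) = (Set.Ioi (0:ℝ)).indicator F s := by
    intro s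
    by_cases hs : 0 < s
    · rw [Set.indicator_of_mem (show s ∈ Set.Ioi (0:ℝ) from hs)]
      apply le_antisymm
      · exact iSup_le fun n => Set.indicator_le_self _ _ s
      · obtain ⟨n, hn⟩ := exists_nat_ge s
        have hmem : s ∈ Set.Ioc (0:ℝ) ((n : ℝ) + 1) := ⟨hs, by linarith⟩
        calc F s = (Set.Ioc (0:ℝ) ((n : ℝ) + 1)).indicator F s := (Set.indicator_of_mem hmem F).symm
          _ ≤ ⨆ n : ℕ, (Set.Ioc (0:ℝ) ((n : ℝ) + 1)).indicator F s :=
              le_iSup (fun n : ℕ => (Set.Ioc (0:ℝ) ((n : ℝ) + 1)).indicator F s) n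
    · rw [Set.indicator_of_notMem (show s ∉ Set.Ioi (0:ℝ) from hs)]
      refine le_antisymm (iSup_le fun n => ?_) zero_le
      rw [Set.indicator_of_notMem]
      exact fun h => hs h.1
  calc ∫⁻ s in Set.Ioi (0 : ℝ), F s = ∫⁻ s, (Set.Ioi (0:ℝ)).indicator F s := (lintegral_indicator measurableSet_Ioi F).symm
    _ = ∫⁻ s, ⨆ n : ℕ, (Set.Ioc (0:ℝ) ((n : ℝ) + 1)).indicator F s := lintegral_congr fun s => (hunion s).symm
    _ = ⨆ n : ℕ, ∫⁻ s, (Set.Ioc (0:ℝ) ((n : ℝ) + 1)).indicator F s :=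
        lintegral_iSup (fun n => hFm.indicator measurableSet_Ioc) hmono
    _ ≤ ∫⁻ x in A, ENNReal.ofReal (ρ x) := iSup_le fun n => by
        rw [lintegral_indicator measurableSet_Ioc]
        exact hle n

end Forward

/-- Registered helper (notation-free restatement of `lintegral_Ioi_kernel_le_src`). -/
theorem helper_flipForwardResolventIneq : ∀ (N : ℕ) (P : Literature.MathematicalPhysics.KineticTheory.HeatConduction.OscillatorChain), ContDiff ℝ ((⊤ : ℕ∞) : WithTop ℕ∞) P.U → ContDiff ℝ ((⊤ : ℕ∞) : WithTop ℕ∞) P.V → 0 < N → ∀ (T_L T_R : ℝ), 0 ≤ T_L → 0 ≤ T_R → ∀ (ρ : Literature.MathematicalPhysics.KineticTheory.HeatConduction.PhaseSpace N → ℝ), ContDiff ℝ 2 ρ → (∀ x, 0 ≤ ρ x) → MeasureTheory.Integrable ρ MeasureTheory.volume → ∀ (c : ℝ) (g : Literature.MathematicalPhysics.KineticTheory.HeatConduction.PhaseSpace N → ℝ), Continuous g → (∀ x, 0 ≤ g x) → MeasureTheory.Integrable g MeasureTheory.volume → (∀ x, Literature.MathematicalPhysics.KineticTheory.sdeGenerator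 (fun y => -P.drift N y) (P.bathVecL N T_L) (P.bathVecR N T_R) ρ x + c * ρ x + g x = 0) → (∃ (C : ℝ) (d : ℕ), 0 ≤ C ∧ ∀ R : ℝ, 1 ≤ R → (MeasureTheory.volume {x : Literature.MathematicalPhysics.KineticTheory.HeatConduction.PhaseSpace N | P.hamiltonian N x ≤ 4 * R}).toReal ≤ C * R ^ d) → P.IsConfining → ∀ (A : Set (Literature.MathematicalPhysics.KineticTheory.HeatConduction.PhaseSpace N)), MeasurableSet A → MeasureTheory.lintegral (MeasureTheory.volume.restrict (Set.Ioi (0 : ℝ))) (fun s => ENNReal.ofReal (Real.exp ((c - 2 * P.γ) * s)) * MeasureTheory.lintegral MeasureTheory.volume (fun x => ENNReal.ofReal (g x) * (P.langevinKernel N T_L T_R s.toNNReal x) A)) ≤ MeasureTheory.lintegral (MeasureTheory.volume.restrict A) (fun x => ENNReal.ofReal (ρ x)) :=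
  fun _ _ hU hV hN _ _ hTL hTR _ hρ hρ0 hρi _ _ hg hg0 hgi hpde hvol hP _ hA =>
    lintegral_Ioi_kernel_le_src hU hV hN hTL hTR hρ hρ0 hρi hg hg0 hgi hpde hvol hP hA

end Summit.AtomisticToContinuum.FouriersLaw.Theorems.NoisyFourier.FlipResolvent

end
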